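import Mathlib
import Literature.Computability.Complexity.CircuitSemantics
import Summits.PneNP.PneNP.Theorems.ConvexRankGatesConvexGateBlindHomogenise

/-!
# PneNP / ConvexRankGates — `ConvexGateBlind`: `{∧₂, ∨₂} ∪ CONV` circuits collapse to ONE CONV gate

Helper (`--supports stmt-PneNP-10680`) toward the crux `ConvexGateBlind` of route `ConvexRankGates`.
`circuit_collapse`: every circuit with `t` gates over `{∧₂, ∨₂} ∪ CONV_s` on a finite input type
`ι`, whose output is a gate, computes the SAME Boolean function as one CONV gate reading the inputs
directly, of description `p + q ≤ 4 (s+1) (t+1) (|ι| + t + 2)` — the semidefinite analogue of the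
weak-wire normal form for monotone linear-programming circuits (Oliveira–Pudlák, ToCT 2019,
Thm 4.3): homogenise each gate by a scalar `zⱼ` (`zⱼ > 0` certifies wire `j`), linearise
`zⱼ · [wire r]` by `w_{j,r}`, pack all blocks into one PSD variable (`blockDiagonal`), demand
`z_out ≥ 1`. Consequently (`ConvexRankGatesConvexGateBlindSingleGate.lean`) the crux is EQUIVALENT to
its single-gate case: a psd-formulation lower bound for `CLIQUE(m, ⌈m^δ⌉₊)`.
-/

namespace Summit.PneNP.PneNP.Theorems

open Matrix Finset

/-! ### The collapse -/

section collapse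

open Literature.Computability.Complexity

/-- Size bookkeeping for the collapsed programme. [folklore] -/
theorem collapse_size_bound (s t n : ℕ) :
    t * (s + 1) + (t * (n + t) + (t * (n + t) + 1)) + (s + 1) * (t * (n + t + 1 + 1)) ≤
      4 * (s + 1) * (t + 1) * (n + t + 2) := by
  have h : 4 * (s + 1) * (t + 1) * (n + t + 2) =
      t * (s + 1) + (t * (n + t) + (t * (n + t) + 1)) + (s + 1) * (t * (n + t + 1 + 1)) +
        (3 * s * t * n + t * n + 3 * s * t * t + t * t + 9 * s * t + 9 * t + 4 * s * n + 4 * n +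
          8 * s + 7) := by ring
  exact Nat.le.intro h.symm

/-- **Single-gate collapse** (the `{∧₂, ∨₂} ∪ CONV_s` analogue of Oliveira–Pudlák's weak-wire
normal form, ToCT 2019, Thm 4.3). Every circuit with `t` gates over `{∧₂, ∨₂} ∪ CONV_s` on the input
type `ι` whose output is a gate computes ONE CONV gate reading the inputs directly, with
`p + q ≤ 4 (s+1) (t+1) (|ι| + t + 2)`: homogenise the programme of gate `j` by a scalar `zⱼ ≥ 0`
(`zⱼ > 0` certifies wire `j` true), linearise the products `zⱼ · [wire r]` by `w_{j,r} ≤ zⱼ`,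
`w_{j,r} ≤ [value of r]`, pack everything block-diagonally into one PSD variable, and demand
`z_out ≥ 1`; soundness is `collapse_sound` (divide by `zⱼ`, `B ≥ 0`), completeness `collapse_complete`
(the 0/1 point). [cite: OliveiraPudlak2019, Thm 4.3] -/
theorem circuit_collapse {ι : Type*} [Fintype ι] [DecidableEq ι] {s : ℕ} (C : Circuit ι)
    (hC : C.IsOver (({GateFn.and 2, GateFn.or 2} : Set GateFn) ∪
      {g | ∃ (p q : ℕ), p + q ≤ s ∧ ∃ (A : Fin p → Matrix (Fin q) (Fin q) ℝ) (b : Fin p → ℝ)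
        (B : Fin p → Fin g.1 → ℝ), (∀ i j, 0 ≤ B i j) ∧ ∀ v : Fin g.1 → Bool, g.2 v = true ↔
          ∃ Y : Matrix (Fin q) (Fin q) ℝ, Y.PosSemidef ∧
            ∀ i, (A i * Y).trace ≤ b i + ∑ j, B i j * (if v j then (1 : ℝ) else 0)}))
    {mo : ℕ} (hout : C.output = Sum.inr mo) :
    ∃ (p q : ℕ) (A : Fin p → Matrix (Fin q) (Fin q) ℝ) (b : Fin p → ℝ) (B : Fin p → ι → ℝ),
      p + q ≤ 4 * (s + 1) * (C.size + 1) * (Fintype.card ι + C.size + 2) ∧ (∀ i e, 0 ≤ B i e) ∧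
      ∀ x : ι → Bool, C.eval x = true ↔ ∃ Y : Matrix (Fin q) (Fin q) ℝ, Y.PosSemidef ∧
        ∀ i, (A i * Y).trace ≤ b i + ∑ e, B i e * (if x e then (1 : ℝ) else 0) := by
  -- Step 0: the output gate exists, so `t > 0`
  have hmo : mo < C.gates.length := C.wf_output mo hout
  have htpos : 0 < C.gates.length := by omega
  -- Step 1: normal-form data of every gate
  have hnf : ∀ j : Fin C.gates.length, ∃ (A : Fin (s + 1) → Matrix (Fin (s + 1)) (Fin (s + 1)) ℝ)
      (b : Fin (s + 1) → ℝ) (B : Fin (s + 1) → Fin (C.gates[j]).arity → ℝ), (∀ i a, 0 ≤ B i a) ∧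
      ∀ u : Fin (C.gates[j]).arity → Bool, (C.gates[j]).op u = true ↔
        ∃ Y : Matrix (Fin (s + 1)) (Fin (s + 1)) ℝ, Y.PosSemidef ∧
          ∀ i, (A i * Y).trace ≤ b i + ∑ a, B i a * (if u a then (1 : ℝ) else 0) :=
    fun j => gate_normalForm (hC _ (List.getElem_mem j.2))
  choose A b B hB hiff using hnf
  -- Step 2: wire references into `ι ⊕ Fin t`
  let toFin : ℕ → Fin C.gates.length := fun m => ⟨m % C.gates.length, Nat.mod_lt _ htpos⟩
  have htoFin : ∀ m, m < C.gates.length → (toFin m).val = m := fun m hm => Nat.mod_eq_of_lt hm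
  let ref : (j : Fin C.gates.length) → Fin (C.gates[j]).arity → ι ⊕ Fin C.gates.length :=
    fun j a => Sum.map id toFin ((C.gates[j]).args a)
  have href : ∀ j a m, ref j a = Sum.inr m → m < j := by
    intro j a m h
    simp only [ref] at h
    cases hargs : (C.gates[j]).args a with
    | inl e =>
      rw [hargs] at h
      simp at h
    | inr m₀ =>
      rw [hargs] at h
      simp only [Sum.map_inr, Sum.inr.injEq] at h
      have hm₀ : m₀ < j.val := C.wf j j.2 a m₀ hargs
      subst h
      show (toFin m₀).val < j.val
      rw [htoFin m₀ (hm₀.trans j.2)]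
      exact hm₀
  -- Step 3: the true transcript satisfies the gate equations
  have hW : ∀ x : ι → Bool, ∀ j : Fin C.gates.length, (transcript x [] C.gates).getD j false =
      (C.gates[j]).op (fun a => Sum.elim x
        (fun m : Fin C.gates.length => (transcript x [] C.gates).getD m false) (ref j a)) := by
    intro x j
    rw [getD_transcript_eq_gateValue C x j j.2]
    unfold gateValue
    congr 1
    funext a
    simp only [ref]
    cases hargs : (C.gates[j]).args a with
    | inl e => rfl
    | inr m₀ =>
      have hm₀ : m₀ < j.val := C.wf j j.2 a m₀ hargs
      show (transcript x [] C.gates).getD m₀ false =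
        (transcript x [] C.gates).getD (m₀ % C.gates.length) false
      rw [Nat.mod_eq_of_lt (hm₀.trans j.2)]
  have heval : ∀ x, C.eval x = (transcript x [] C.gates).getD mo false := by
    intro x
    rw [eval_eq_wireVal, hout]
    rfl
  -- Step 4: the single programme on structured index types
  -- keys: `(j, none)` = PSD block of gate `j`; `(j, some none)` = the scalar `z j`;
  -- `(j, some (some r))` = the linearised product `w j r`
  let E : ℝ → Matrix (Fin (s + 1)) (Fin (s + 1)) ℝ := fun c => Matrix.single 0 0 c
  let coef : (j : Fin C.gates.length) → Fin (s + 1) → (ι ⊕ Fin C.gates.length) → ℝ :=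
    fun j i r => ∑ a, if ref j a = r then B j i a else 0
  let zk : Fin C.gates.length → Fin C.gates.length × Option (Option (ι ⊕ Fin C.gates.length)) :=
    fun j => (j, some none)
  let wk : Fin C.gates.length → (ι ⊕ Fin C.gates.length) →
      Fin C.gates.length × Option (Option (ι ⊕ Fin C.gates.length)) :=
    fun j r => (j, some (some r))
  let A' : (Fin C.gates.length × Fin (s + 1)) ⊕ (Fin C.gates.length × (ι ⊕ Fin C.gates.length)) ⊕
      (Fin C.gates.length × (ι ⊕ Fin C.gates.length)) ⊕ Unit →
      Matrix (Fin (s + 1) × (Fin C.gates.length × Option (Option (ι ⊕ Fin C.gates.length))))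
        (Fin (s + 1) × (Fin C.gates.length × Option (Option (ι ⊕ Fin C.gates.length)))) ℝ :=
    Sum.elim
      (fun ji => blockDiagonal fun k => if k.1 = ji.1 then
        k.2.elim (A ji.1 ji.2) (fun o => o.elim (E (-(b ji.1 ji.2))) (fun r => E (-(coef ji.1 ji.2 r))))
        else 0)
      (Sum.elim
        (fun jr => blockDiagonal fun k =>
          if k = wk jr.1 jr.2 then E 1 else if k = zk jr.1 then E (-1) else 0)
        (Sum.elim
          (fun jr => Sum.elim
            (fun e => blockDiagonal fun k => if k = wk jr.1 (Sum.inl e) then E 1 else 0)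
            (fun m => blockDiagonal fun k =>
              if k = wk jr.1 (Sum.inr m) then E 1 else if k = zk m then E (-1) else 0) jr.2)
          (fun _ => blockDiagonal fun k => if k = zk (toFin mo) then E (-1) else 0)))
  let b' : (Fin C.gates.length × Fin (s + 1)) ⊕ (Fin C.gates.length × (ι ⊕ Fin C.gates.length)) ⊕
      (Fin C.gates.length × (ι ⊕ Fin C.gates.length)) ⊕ Unit → ℝ :=
    Sum.elim (fun _ => 0) (Sum.elim (fun _ => 0) (Sum.elim (fun _ => 0) (fun _ => -1)))
  let B' : (Fin C.gates.length × Fin (s + 1)) ⊕ (Fin C.gates.length × (ι ⊕ Fin C.gates.length)) ⊕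
      (Fin C.gates.length × (ι ⊕ Fin C.gates.length)) ⊕ Unit → ι → ℝ :=
    Sum.elim (fun _ _ => 0) (Sum.elim (fun _ _ => 0)
      (Sum.elim (fun jr e' => Sum.elim (fun e => if e' = e then 1 else 0) (fun _ => 0) jr.2)
        (fun _ _ => 0)))
  have hB' : ∀ l e, 0 ≤ B' l e := by
    intro l e'
    rcases l with ji | jr | ⟨j, e | m⟩ | u
    · exact le_refl _
    · exact le_refl _
    · show (0 : ℝ) ≤ if e' = e then 1 else 0
      split_ifs <;> norm_num
    · exact le_refl _
    · exact le_refl _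
  -- Step 5: what the rows say, for an ARBITRARY matrix `Y` (accessors: block / z / w)
  have hE : ∀ (c : ℝ) (k : Fin C.gates.length × Option (Option (ι ⊕ Fin C.gates.length)))
      (Y : Matrix (Fin (s + 1) × (Fin C.gates.length × Option (Option (ι ⊕ Fin C.gates.length))))
        (Fin (s + 1) × (Fin C.gates.length × Option (Option (ι ⊕ Fin C.gates.length)))) ℝ),
      (E c * Y.submatrix (fun a => (a, k)) (fun a => (a, k))).trace = c * Y (0, k) (0, k) := by
    intro c k Y
    simp only [E]
    rw [trace_single_mul]
    rfl
  have hzw : ∀ (j : Fin C.gates.length) (r : ι ⊕ Fin C.gates.length), wk j r ≠ zk j := by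
    intro j r h
    simp only [wk, zk, Prod.mk.injEq] at h
    exact Option.some_ne_none _ (Option.some_injective _ h.2)
  have hzw' : ∀ (j m : Fin C.gates.length), wk j (Sum.inr m) ≠ zk m := by
    intro j m h
    simp only [wk, zk, Prod.mk.injEq] at h
    exact Option.some_ne_none _ (Option.some_injective _ h.2)
  have hrow : ∀ (x : ι → Bool)
      (Y : Matrix (Fin (s + 1) × (Fin C.gates.length × Option (Option (ι ⊕ Fin C.gates.length))))
        (Fin (s + 1) × (Fin C.gates.length × Option (Option (ι ⊕ Fin C.gates.length)))) ℝ),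
      (∀ l, (A' l * Y).trace ≤ b' l + ∑ e, B' l e * (if x e then (1 : ℝ) else 0)) ↔
      ((∀ j i, (A j i * Y.submatrix (fun a => (a, (j, none))) (fun a => (a, (j, none)))).trace ≤
          b j i * Y (0, zk j) (0, zk j) + ∑ a, B j i a * Y (0, wk j (ref j a)) (0, wk j (ref j a))) ∧
        (∀ j r, Y (0, wk j r) (0, wk j r) ≤ Y (0, zk j) (0, zk j)) ∧
        (∀ j e, Y (0, wk j (Sum.inl e)) (0, wk j (Sum.inl e)) ≤ if x e then (1 : ℝ) else 0) ∧
        (∀ j m, Y (0, wk j (Sum.inr m)) (0, wk j (Sum.inr m)) ≤ Y (0, zk m) (0, zk m)) ∧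
        (1 ≤ Y (0, zk (toFin mo)) (0, zk (toFin mo)))) := by
    intro x Y
    -- the four kinds of rows, computed
    have r1 : ∀ j i, (A' (Sum.inl (j, i)) * Y).trace =
        (A j i * Y.submatrix (fun a => (a, (j, none))) (fun a => (a, (j, none)))).trace +
          (-(b j i) * Y (0, zk j) (0, zk j) +
            ∑ r, -(coef j i r) * Y (0, wk j r) (0, wk j r)) := by
      intro j i
      simp only [A', Sum.elim_inl]
      rw [trace_blockDiagonal_mul, Fintype.sum_prod_type, Finset.sum_eq_single j]
      · rw [Fintype.sum_option, Fintype.sum_option]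
        simp only [if_true, Option.elim_none, Option.elim_some]
        rw [hE]
        congr 2
        exact Finset.sum_congr rfl fun r _ => hE _ _ _
      · intro j' _ hj'
        refine Finset.sum_eq_zero fun o _ => ?_
        rw [if_neg hj', Matrix.zero_mul, Matrix.trace_zero]
      · intro h
        exact absurd (Finset.mem_univ j) h
    have r1' : ∀ j i, ∑ r, -(coef j i r) * Y (0, wk j r) (0, wk j r) =
        -∑ a, B j i a * Y (0, wk j (ref j a)) (0, wk j (ref j a)) := by
      intro j i
      calc ∑ r, -(coef j i r) * Y (0, wk j r) (0, wk j r)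
          = -∑ r, coef j i r * Y (0, wk j r) (0, wk j r) := by
            rw [← Finset.sum_neg_distrib]
            exact Finset.sum_congr rfl fun r _ => neg_mul _ _
        _ = -∑ r, ∑ a, (if ref j a = r then B j i a * Y (0, wk j r) (0, wk j r) else 0) := by
            congr 1
            refine Finset.sum_congr rfl fun r _ => ?_
            simp only [coef, Finset.sum_mul]
            refine Finset.sum_congr rfl fun a _ => ?_
            rw [ite_mul, zero_mul]
        _ = -∑ a, ∑ r, (if ref j a = r then B j i a * Y (0, wk j r) (0, wk j r) else 0) := by
            rw [Finset.sum_comm]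
        _ = -∑ a, B j i a * Y (0, wk j (ref j a)) (0, wk j (ref j a)) := by
            congr 1
            refine Finset.sum_congr rfl fun a _ => ?_
            rw [Finset.sum_ite_eq]
            simp
    have r2 : ∀ j r, (A' (Sum.inr (Sum.inl (j, r))) * Y).trace =
        Y (0, wk j r) (0, wk j r) - Y (0, zk j) (0, zk j) := by
      intro j r
      simp only [A', Sum.elim_inr, Sum.elim_inl]
      rw [trace_blockDiagonal_ite_ite_mul (hzw j r), hE, hE]
      ring
    have r3 : ∀ j e, (A' (Sum.inr (Sum.inr (Sum.inl (j, Sum.inl e)))) * Y).trace =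
        Y (0, wk j (Sum.inl e)) (0, wk j (Sum.inl e)) := by
      intro j e
      simp only [A', Sum.elim_inr, Sum.elim_inl]
      rw [trace_blockDiagonal_ite_mul, hE, one_mul]
    have r3' : ∀ j m, (A' (Sum.inr (Sum.inr (Sum.inl (j, Sum.inr m)))) * Y).trace =
        Y (0, wk j (Sum.inr m)) (0, wk j (Sum.inr m)) - Y (0, zk m) (0, zk m) := by
      intro j m
      simp only [A', Sum.elim_inr, Sum.elim_inl]
      rw [trace_blockDiagonal_ite_ite_mul (hzw' j m), hE, hE]
      ring
    have r4 : (A' (Sum.inr (Sum.inr (Sum.inr ()))) * Y).trace = -Y (0, zk (toFin mo)) (0, zk (toFin mo)) := by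
      simp only [A', Sum.elim_inr]
      rw [trace_blockDiagonal_ite_mul, hE]
      ring
    have rB3 : ∀ j (e : ι), ∑ e', B' (Sum.inr (Sum.inr (Sum.inl (j, Sum.inl e)))) e' *
        (if x e' then (1 : ℝ) else 0) = if x e then (1 : ℝ) else 0 := by
      intro j e
      simp only [B', Sum.elim_inr, Sum.elim_inl]
      simp_rw [ite_mul, one_mul, zero_mul]
      rw [Finset.sum_ite_eq']
      simp
    -- assemble
    constructor
    · intro h
      refine ⟨fun j i => ?_, fun j r => ?_, fun j e => ?_, fun j m => ?_, ?_⟩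
      · have := h (Sum.inl (j, i))
        simp only [b', B', Sum.elim_inl, zero_mul, Finset.sum_const_zero, add_zero] at this
        rw [r1, r1'] at this
        linarith
      · have := h (Sum.inr (Sum.inl (j, r)))
        simp only [b', B', Sum.elim_inl, Sum.elim_inr, zero_mul, Finset.sum_const_zero,
          add_zero] at this
        rw [r2] at this
        linarith
      · have := h (Sum.inr (Sum.inr (Sum.inl (j, Sum.inl e))))
        rw [r3, rB3] at this
        simp only [b', Sum.elim_inl, Sum.elim_inr, zero_add] at this
        exact this
      · have := h (Sum.inr (Sum.inr (Sum.inl (j, Sum.inr m))))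
        simp only [b', B', Sum.elim_inl, Sum.elim_inr, zero_mul, Finset.sum_const_zero,
          add_zero] at this
        rw [r3'] at this
        linarith
      · have := h (Sum.inr (Sum.inr (Sum.inr ())))
        simp only [b', B', Sum.elim_inr, zero_mul, Finset.sum_const_zero, add_zero] at this
        rw [r4] at this
        linarith
    · rintro ⟨h1, h2, h3, h4, h5⟩ l
      rcases l with ⟨j, i⟩ | ⟨j, r⟩ | ⟨j, e | m⟩ | u
      · simp only [b', B', Sum.elim_inl, zero_mul, Finset.sum_const_zero, add_zero]
        rw [r1, r1']
        linarith [h1 j i]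
      · simp only [b', B', Sum.elim_inl, Sum.elim_inr, zero_mul, Finset.sum_const_zero, add_zero]
        rw [r2]
        linarith [h2 j r]
      · rw [r3, rB3]
        simp only [b', Sum.elim_inl, Sum.elim_inr, zero_add]
        exact h3 j e
      · simp only [b', B', Sum.elim_inl, Sum.elim_inr, zero_mul, Finset.sum_const_zero, add_zero]
        rw [r3']
        linarith [h4 j m]
      · simp only [b', B', Sum.elim_inr, zero_mul, Finset.sum_const_zero, add_zero]
        rw [r4]
        linarith
  -- Step 6: semantics of the structured programme
  have hsem : ∀ x : ι → Bool, C.eval x = true ↔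
      ∃ Y : Matrix (Fin (s + 1) × (Fin C.gates.length × Option (Option (ι ⊕ Fin C.gates.length))))
        (Fin (s + 1) × (Fin C.gates.length × Option (Option (ι ⊕ Fin C.gates.length)))) ℝ,
        Y.PosSemidef ∧ ∀ l, (A' l * Y).trace ≤ b' l + ∑ e, B' l e * (if x e then (1 : ℝ) else 0) := by
    intro x
    rw [heval x]
    constructor
    · -- completeness: the 0/1 point of the true transcript
      intro hx
      obtain ⟨z, w, Yb, hz0, hw0, hYb, h1, h2, h3, h4, h5⟩ := collapse_complete
        (fun j => (C.gates[j]).arity) (fun j => (C.gates[j]).op) ref A b B hiff x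
        (fun m => (transcript x [] C.gates).getD m false) (hW x)
      refine ⟨blockDiagonal fun k => k.2.elim (Yb k.1) (fun o => o.elim (E (z k.1)) (fun r => E (w k.1 r))),
        posSemidef_blockDiagonal_of_forall fun k => ?_, ?_⟩
      · rcases k with ⟨j, _ | _ | r⟩
        · exact hYb j
        · exact posSemidef_single_diag 0 (hz0 j)
        · exact posSemidef_single_diag 0 (hw0 j r)
      · rw [hrow]
        have hblk : ∀ j : Fin C.gates.length,
            (blockDiagonal fun k : Fin C.gates.length × Option (Option (ι ⊕ Fin C.gates.length)) =>
              k.2.elim (Yb k.1) (fun o => o.elim (E (z k.1)) (fun r => E (w k.1 r)))).submatrix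
              (fun a => (a, (j, none))) (fun a => (a, (j, none))) = Yb j :=
          fun j => submatrix_blockDiagonal_prod _ (j, none)
        have hzv : ∀ j : Fin C.gates.length,
            (blockDiagonal fun k : Fin C.gates.length × Option (Option (ι ⊕ Fin C.gates.length)) =>
              k.2.elim (Yb k.1) (fun o => o.elim (E (z k.1)) (fun r => E (w k.1 r))))
              (0, zk j) (0, zk j) = z j := by
          intro j
          rw [blockDiagonal_apply_eq]
          simp [zk, E]
        have hwv : ∀ (j : Fin C.gates.length) (r : ι ⊕ Fin C.gates.length),
            (blockDiagonal fun k : Fin C.gates.length × Option (Option (ι ⊕ Fin C.gates.length)) =>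
              k.2.elim (Yb k.1) (fun o => o.elim (E (z k.1)) (fun r => E (w k.1 r))))
              (0, wk j r) (0, wk j r) = w j r := by
          intro j r
          rw [blockDiagonal_apply_eq]
          simp [wk, E]
        simp only [hblk, hzv, hwv]
        refine ⟨h1, h2, h3, h4, ?_⟩
        rw [h5 (toFin mo) ?_]
        show (transcript x [] C.gates).getD (toFin mo).val false = true
        rw [htoFin mo hmo]
        exact hx
    · -- soundness: divide by `z`, induct along the wires
      rintro ⟨Y, hY, hrows⟩
      rw [hrow] at hrows
      obtain ⟨h1, h2, h3, h4, h5⟩ := hrows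
      have key := collapse_sound (fun j => (C.gates[j]).arity) (fun j => (C.gates[j]).op) ref href
        A b B hB hiff x (fun m => (transcript x [] C.gates).getD m false) (hW x)
        (fun j => Y (0, zk j) (0, zk j)) (fun j r => Y (0, wk j r) (0, wk j r))
        (fun j => Y.submatrix (fun a => (a, (j, none))) (fun a => (a, (j, none))))
        (fun j => hY.diag_nonneg) (fun j => hY.submatrix _) h1 h2 h3 h4
      have := key (toFin mo) (by linarith)
      have hfin : ((toFin mo) : ℕ) = mo := htoFin mo hmo
      rw [hfin] at this
      exact this
  -- Step 7: re-index to `Fin p × Fin q` and count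
  obtain ⟨A'', b'', B'', hB'', hiff''⟩ := conv_feasible_reindex A' b' B'
  refine ⟨_, _, A'', b'', B'', ?_, fun i e => (hB'' i e).symm ▸ hB' _ _,
    fun x => (hsem x).trans (hiff'' x)⟩
  simp only [Fintype.card_sum, Fintype.card_prod, Fintype.card_fin, Fintype.card_option,
    Fintype.card_unit]
  exact collapse_size_bound s C.gates.length (Fintype.card ι)

end collapse

end Summit.PneNP.PneNP.Theorems
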